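import Summits.ResolutionOfSingularities.ResolutionOfSingularities.Theorems.WeakOrderReduction
import Summits.ResolutionOfSingularities.ResolutionOfSingularities.Theorems.GenericPointCutClasses
import Summits.ResolutionOfSingularities.ResolutionOfSingularities.Theorems.FaceFormCutClasses
import Literature.AlgebraicGeometry.Resolution.HironakaTauScheme
import Literature.AlgebraicGeometry.Resolution.BlowupSequences
import Literature.AlgebraicGeometry.Resolution.MarkedIdeals
import Mathlib.FieldTheory.IsAlgClosed.AlgebraicClosure
import Mathlib.Algebra.CharP.Defs

/-!
# DeltaFaceCut — the located dimension-four core cut by the δ-FACE of the characteristic polyhedron and the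
BLOW-UP PACKAGE it dictates (decomp-res lens-2 «structural dichotomy (special vs generic)», g11)

[WRITER NOTE (decomp-res writer g4). This Theorems file is the VOCABULARY (§§0–4: weights, the δ-face presentation
and the genericity predicates, the ENGINE `DeltaPackageExit` and the port `PackagePort`, the pointwise classes and the
graded statements) of the lens-2 g11 node `DeltaFaceCut` (critic row 75, CRITIC-LEDGER line 96, CLEARED), Theses-free.
The PROVED pure-logic kernels of §5 that do not name route items are `Theorems.DeltaFaceCutKernels`; the kernels naming
`MaxContactCut` items BY NAME (`rungOne_iff`, `closes*`, `closes_core`, `closes_closedPointCore`, the §6 refinement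
edges to 31576–31579) and the wiring to the new asides `DFGenericRung`, `DFSpecialRung`, `DFSpecialNonIso`,
`DFSpecialIso` are `Theorems.MaxContactCutDeltaFaceCut`.  The paper proof of the engine below is kept verbatim: it is
the blueprint for prover target #19″ (`DeltaPackageExit`).]

ROOT DECOMPOSITION CELL `decomp-res`, RESIDUAL MODE (D-0179), generation 11.  TARGET (tree items, BY NAME):
`MaxContactCut.RungOne` (stmt-29273, `E 2 → E 1`, the dimension-four core of the order axis in SEQUENCE form), with the
map edges to `MaxContactCut.StepPICoreDimFour` (28544, kernel `MaxContactCutTauLadder.closes`) and to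
`MaxContactCut.ClosedPointCoreAll` (30461, kernel `MaxContactCutGenericPointCut.rungOne_iff_core_of_rounds`), and the
refinement edges to the tree's g9 asides `MaxContactCut.FFGenericRung` 31576 / `FFSpecialRung` 31577 / `FFSpecialDeep`
31578 / `FFSpecialCritical` 31579 (`Theorems.FaceFormCutClasses`, `Theorems.MaxContactCutFaceFormCut`; every g9 notion is
used BY NAME, nothing re-typed).

CRITIC DIRECTION HONOURED (CRITIC-LEDGER row 66 on g10): «face-form invariants (`Φ`, degree `n+1`) are TERMINAL in frame;
the next lens-2 object must be a weighted / δ-initial form (first face of the characteristic polyhedron)».  This node's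
NEW OBJECT is exactly that: the δ-FACE PRESENTATION of the stalk ideal at a core top point and the genericity of its
δ-INITIAL FORM, for EVERY slope `δ = a/b > 1` — g9 (`δ = 1 + 1/n`, one blow-up, threshold `max(2, n−1)`) and g10 (same
δ, very-near test) are its first instance.  What is new in kind: the decided class is no longer served by ONE blow-up but
by the m-PACKAGE `(y, C₁, …, C_{m−1})`, `m = ⌈δ⌉ − 1`, of blow-ups DICTATED BY THE FACE, and the ENGINE proves the
package exits at every slope.

## The new parameter: the δ-face presentation `(c; a, b; F)` at a top point

`y` a top point of order `n ≥ 2` of the ideal sheaf `I` on the regular scheme `Y`, `R = 𝒪_{Y,y}`, `k = k(y)`,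
`J = I_y`, `c = (c₀ = z, u₁, …, u_d)` a (minimal) regular system of parameters.  WEIGHTS `a > b > 0` (`z ↦ a`,
`u_j ↦ b`), slope `δ := a/b > 1`; `Q(λ) :=` the ideal generated by the monomials `zⁱuᵅ` with `a i + b|α| ≥ λ`
(`qWeighted c a b λ`; the monomial valuation ideals of the weight — intrinsic in `(R, c, a, b)`).
`HasDeltaFace c J n a b F` :⟺ `J ⊆ Q(an)` (the WHOLE ideal is δ-deep) and `J ∋ f = zⁿ + F(c) + G(c)` with `F` supported
on monomials of weight EXACTLY `an` with `z`-degree `< n` and `G` on monomials of weight `> an`.  The δ-INITIAL FORM is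
`F̄ := F mod 𝔪 ∈ k[Z, U₁, …, U_d]`, `F̄ = Σ_{i<n} Zⁱ Ψ_i(U)`, `Ψ_i` a form of degree `δ(n−i)` (zero unless integral):
Hironaka's `in_δ(f) − Zⁿ` ([Hironaka1967]; [CossartJannsenSaito2020] Ch. 8; the tree's
`Literature…CossartPiltant.delta / DeltaGE / monomialIdeal` of `ArithmeticalThreefoldsLocalPolyhedron` are the `R = S[z]`
forms of `δ ≥ a/b ⟺ J ⊆ Q`).  Put `m := ⌈δ⌉ − 1 ≥ 1` (`packageLength a b`) and `θ := ⌈δ⌉ − δ ∈ [0,1)`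
(`θ = thetaNum a b / b`, `thetaNum a b = b − a mod b` when `b ∤ a`; `θ = 0` iff `δ ∈ ℤ`).

GENERICITY of `F̄` (tested at the GEOMETRIC points `v` of `P := {Y₀ = 0} ≅ ℙ^{d−1}`, `μ_i(v) := mult_v Ψ_i`):
 (G1) `ThresholdGeneric`    (`δ ∉ ℤ`): at every `v` some `i < n` has `μ_i(v) < θ(n−i)`;
 (G2) `ThresholdGenericPow` (`δ ∉ ℤ`, `n = pᵉ`, `p = char k`): at every `v` some `i` has `μ_i(v) ≤ θ(n−i)`;
 (G3) `SolvGeneric`         (`δ ∈ ℤ`): at every `v ≠ 0` the monic `Zⁿ + F̄(Z, v) ∈ k̄[Z]` is NOT `(Z +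
t)ⁿ`, `t ∈ k̄`.
`DeltaGenericFace := G1 ∨ G2 ∨ G3`.  At `δ = 1 + 1/n` (`a = n+1`, `b = n`, `m = 1`, `θ = (n−1)/n`): G1 is g9's threshold
`mult Φ ≤ n − 2` and G2 (for `n = pᵉ`) is g10's near-generic face `mult Φ ≤ n − 1`; every other slope is NEW.

## THE ENGINE `DeltaPackageExit` (DECIDED — paper proof here; characteristic free, EVERY regular scheme, EVERY residue
field, every dimension; port L over the tree's `CentreSeq` / `controlledTransform` / `stalkTau` apparatus)

CLAIM.  `Y` regular, `y` closed, `ord_y I = n ≥ 2`, `c` a minimal regular system at `y`, `HasDeltaFace c I_y n a b F`,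
`DeltaGenericFace F̄ n a b`.  Then the PACKAGE `s = (π₁, …, π_m)` — `π₁` the blow-up of the reduced
closed point `y`,
`π_{j+1}` the blow-up of `C_j := E_j ∩ H_j` (`E_j` the exceptional divisor of `π_j`, `H_j` the strict transform of
`H = V(z)`) — is WEAKLY ADMISSIBLE for `(I, ∅, n)`, has all centres over `y`, regular top, and EXITS: every point `x` of
`Y_m` over `y` with `ord_x I^{(m)} = n` has `τ(x) ≥ 2` (under G1 there is no such point).  (`PackageExitsAt I n y`.)

PROOF.  (0) STRUCTURE.  `E₁ = Proj k[Z, U] ≅ ℙ^d_k`, `C₁ = {Z = 0} ≅ ℙ^{d−1}_k`; inductively `C_j ⊂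
H_j` is regular of
codimension one, so `H_{j+1} ≅ H_j`, `E_{j+1} = ℙ(N_{C_j/Y_j})` is a `ℙ¹`-bundle over `C_j` and `C_{j+1} = E_{j+1} ∩
H_{j+1} ≅ C_j ≅ ℙ^{d−1}_k`: all centres are regular `k`-schemes over `y`; blow-ups of a regular scheme in regular
centres are regular ([Hartshorne1977] II 8.24; [CossartJannsenSaito2020] Ch. 2), so every `Y_j` is regular.  CHARTS: by
the symmetry of the hypotheses in `u₁, …, u_d` every point of `C_j` lies in an «A-chart»: after `π₁` (chart `u₁`):
`z = z₁u₁`, `u_l = u₁ũ_l` (`l ≥ 2`); after `π_{j+1}` (chart `u₁` of the blow-up of `V(z_j, u₁)`): `z_j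
= z_{j+1}u₁`.  On
the A-chart of `Y_j`: `z = z_j u₁ʲ`, `u_l = u₁ũ_l`, the chart ring is `R[z_j, ũ]`, `E_j = {u₁ = 0}`, `C_j =
V(z_j, u₁)`,
and the controlled transform divides by `u₁^{jn}`: a monomial `zⁱuᵅ` of `f` becomes `z_jⁱ u₁^{e_j(i,α)}
ũ^{α̂}` with
`e_j(i,α) = |α| − j(n−i)`; for `i < n`, `|α| ≥ δ(n−i)` (as `J ⊆ Q(an)`) gives `e_j ≥ (δ − j)(n
− i)`; for `i ≥ n`,
`(i,α) ≠ (n,0)`: `e_j = j(i−n) + |α| ≥ 1` or `i > n`.  The «B-chart» of `π_{j+1}` (`u₁ = z_j w`,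
exceptional divisor
`{z_j = 0}`) and the `z`-chart of `π₁` (`u_l = z w_l`) carry `f^{(j+1)} = 1 + (z_j)` resp. `f^{(1)} = 1 + (z)`: every
monomial other than `zⁿ` acquires a positive exponent `e_{j+1}(i,α) ≥ 1` of the exceptional parameter.
(1) ADMISSIBILITY (`C_j ⊆ Supp(I^{(j)}, n)` for `1 ≤ j ≤ m−1`).  At any point `q ∈ C_j` (A-chart; `z_j,
u₁ ∈ 𝔪_q`) and any
`g ∈ J ⊆ Q(an)`, every term `r·z_jⁱu₁^{e_j}ũ^{α̂}` of `g^{(j)}` has `ord_q ≥ i + e_j ≥ i + (δ −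
j)(n−i) ≥ n`, because
`j ≤ m − 1 = ⌈δ⌉ − 2 < δ − 1`; lower bounds do not see cancellation.  (This is where `J ⊆ Q(an)` —
not only `f` — is used.)
(2) LOCATION (near points over `y` in `Y_j` lie on `C_j`, `1 ≤ j ≤ m`).  A point of `Y_j` over `y` off `E_j` maps
isomorphically to a point of `Y_{j−1}` over `y` off `C_{j−1}`, not near by induction.  On `E_j`: in the A-chart
`f^{(j)} ≡ z_jⁿ (mod u₁)` (all other exponents `e_j(i,α) ≥ 1` since `δ > m ≥ j`), so at a point with
`z_j(x) ≠ 0` the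
transform is a unit; on the B-chart / `z`-chart it is `≡ 1` modulo the exceptional parameter.  Hence near ⟹ `x ∈ C_j`.
(3) THE TEST ON `C_m`.  Let `x ∈ C_m` be ANY point (closed or not, residue field `κ ⊇ k`), `x̄` the corresponding point of
`P = C_m ≅ ℙ^{d−1}_k`, `B̄ := 𝒪_{Y_m,x}/(z_m, u₁) = 𝒪_{P,x̄}` (regular), `(z_m, u₁, w)` a regular system of `𝒪_x` with `w`
lifting one of `B̄`; `gr_x = κ[Z, U₁, W]`.  For `A ∈ 𝒪_x` of order `s` write `in(A) = c_A + Z·D₁ + U₁·D₂` with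
`c_A ∈ κ[W]_s` the image in `gr(B̄) = gr_x/(Z, U₁)` — so `c_A = in_{B̄}(Ā) ≠ 0` iff `ord_x A = ord_{B̄}
Ā` («`A` is
x-PREPARED»).  EXPANSION: `f^{(m)} = z_mⁿ + Σ_{(i,e)} z_mⁱ u₁ᵉ A_{i,e}`, a finite sum over the exponents
produced by the
monomials of `F` and `G` (`A_{i,e} := Σ r_{iα} ũ^{α̂} ∈ R[ũ]`): for `i < n` one has `e ≥ e_i := (δ − m)(n−i) = (1−θ)(n−i)
> 0`, with EQUALITY exactly for the face monomials, and then `Ā_{i,e_i} = Ψ_i(1, Ũ)` (germ at `x̄`), whose order is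
`μ_i(x) := mult_{x̄} Ψ_i`; for `i = n`, `e ≥ 1`; no index has `e = 0, i ≤ n` except `zⁿ`.  x-PREPARATION: if some
`A_{i,e}` is not prepared, `in(A) = Z D₁ + U₁ D₂`; lifting `D₁, D₂` gives `A = z_m Ã₁ + u₁ Ã₂ +
A′` with `ord A′ >
ord A` and `Ā′ = Ā`; move `Ã₁, Ã₂` into the indices `(i+1, e)`, `(i, e+1)` — never a face index, never
`(n,0)` — and
iterate in increasing `i + e` (terms of order `> n` are dumped); this terminates in an expansion with every `A_{i,e}`
PREPARED, the face entries still reducing to `Ψ_i(1,Ũ)` and `zⁿ` untouched.  READING: `ord(z_mⁱu₁ᵉA_{i,e}) = i + e +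
s_{i,e}`; in `gr_x`, bigraded by `(deg_Z, deg_{U₁})`, the summand `(i,e)` contributes `ZⁱU₁ᵉ c_{i,e}(W)` in bidegree
EXACTLY `(i,e)` and its `D`-parts only in bidegrees `> (i,e)` (product order).  Let `σ₀` be the least order of a summand
and `(i,e)` product-minimal among the summands of order `σ₀`: the bidegree-`(i,e)` component of `in_{σ₀}(f^{(m)})` is
`ZⁱU₁ᵉc_{i,e} ≠ 0`.  Hence (no cancellation is possible):
   (N)  `ord_x f^{(m)} = min(n, min_{(i,e)} (i + e + s_{i,e}))`; in particular  x NEAR ⟹ `μ_i(x) ≥ θ(n−i)`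
for all `i < n`
        (face index: `i + e_i + μ_i ≥ n`);
   (I)  at a near `x`, for every product-minimal `(i,e)` with `i + e + s_{i,e} = n` the bidegree-`(i,e)` component of
        `in_n(f^{(m)})` is `ZⁱU₁ᵉ c_{i,e} ≠ 0`.
GEOMETRIC POINTS: for a closed specialisation `x₀ ∈ {x}⁻ ⊆ C_m` and a geometric point `v̄ ∈ P(k̄)` over `x₀`,
`μ_i(x) ≤ μ_i(x₀) ≤ μ_i(v̄)` (upper semicontinuity; `𝔪_{x₀}𝒪 ⊆ 𝔪_{v̄}`).  Now:
 (G1) at `v̄`: some `μ_i(v̄) < θ(n−i)`, so `μ_i(x) < θ(n−i)` and `x` is NOT near by (N): NO near point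
over `y` at all.
 (G2) at a near `x` (`n = pᵉ`): some `μ_i(x) ≤ θ(n−i)`, `= ` by (N), so the face index `(i, e_i)` has order `n`; a
      product-minimal `(i*, e*) ≤ (i, e_i)` of order `n` has `i* < n`, `0 < e* < n`... precisely `(i*,e*) ∉ {(n,0), (0,n),
      (0,0)}` (`e* ≤ e_i < n`; `(0,0)` is no index), so by (I) `in_n(f^{(m)})` has a non-zero component of bidegree
      `(i*, e*)`, none of whose monomials is a pure `pᵉ`-th power `Vⁿ`; but `τ(x) = 1` means `cl_n(I^{(m)}_x) ⊆ κ·Lⁿ`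
      and `L^{pᵉ} = Σ α_j^{pᵉ} V_j^{pᵉ}` (Frobenius; `char κ = char k = p`): so `τ(x) ≥ 2`.
 (G3) (`θ = 0`, `e_i = n − i`): the summands of order `≤ n` are `zⁿ` and the face entries with `μ_i(x) = 0` (units, no
      `D`-parts), so `in_n(f^{(m)}) = Zⁿ + Σ_{i<n} Ψ_i(ṽ_x) Zⁱ U₁^{n−i}` with `ṽ_x = (1, ũ(x)) ∈
κ^d` the point `x`
      itself; `τ(x) = 1` forces this binary form to be `(Z + tU₁ + γ·W)ⁿ`, the `W_tⁿ`-coefficients give `γ = 0`, i.e.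
      `Zⁿ + F̄(Z, ṽ_x) = (Z + t)ⁿ` over `κ`.  The set of `v` with `Zⁿ + F̄(Z, v)` an `n`-th power of a
linear monic is
      Zariski-closed and defined over `k` (preimage of the closed curve `t ↦ ((n over i) t^{n−i})_i` under `v
↦ (Ψ_i(v))`);
      by G3 it has no `k̄`-point `≠ 0`, hence (Nullstellensatz) no `K`-point `≠ 0` over any field `K ⊇ k` —
contradiction
      at `K = κ`, `v = ṽ_x ≠ 0`.  So `τ(x) ≥ 2`.
Near points at stage `m` over `y` lie on `C_m` by (2); `ord ≤ n` persists on every `Y_j` ([CossartPiltant2008] Prop. 4.2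
(a)).  ∎  — Why `J ⊆ Q(an)` cannot be dropped: for a NON-principal `J` a second generator of small δ-order would leave
`C_j ⊄ Supp` (inadmissible centre); why G2 needs `n = pᵉ`: for `p ∤ n` mixed monomials do occur in `Lⁿ`; why G1 alone is
not enough: at `n = 2` or `δ = 5/3, n = 3` the locus `{μ ≥ θ(n−i)}` is a curve, never empty (bed autopsy in NODE-g11.md).

## Pieces, tags, edges (NODE-g11.md has the table with evidence and leaves)

* `DeltaGenericRung` [WEAKER · DECIDED-MOD-PORT]: `E 2 →` weak order reduction for data all of whose top points are of
  class ≥ 2, face-generic (g9, tree engine `FaceFormExit`) or δ-GENERIC; kernel `deltaGenericRung_of_engines` from the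
  ENGINE `DeltaPackageExit`, the tree engine `FaceFormCutClasses.FaceFormExit`, the port `PackagePort n` [COSTUME(M+)]
  and the tree port `FaceFormCutClasses.OrderOneContact` [COSTUME(S)].
* `DeltaSpecialRung` [WEAKER BY LETTER · located residual · UNDECIDED · score 0]: data with a δ-SPECIAL core top point
  (face-special and in NO regular system / slope δ-generic); EXACT: `RungOne ⟺ DeltaGenericRung ∧ DeltaSpecialRung`
  (`rungOne_iff`), and `DeltaSpecialRung ⟺ Far ∧ Mid ∧ Crit` (`deltaSpecialRung_iff_strata`: FAR = a δ-special top
  point with `δ ≥ 2` in some system, `IsFarPt`; MID = none far but a deep face-special top point; CRIT = no deep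
  face-special top point — nested excluded middle, refining the tree's DEEP/CRITICAL strata 31578/31579 BY NAME);
  and the ISOLATION sub-cut `DeltaSpecialRung ⟺ NonIso ∧ Iso` (`deltaSpecialRung_iff_iso`: NONISO = some δ-special top
  point is not isolated in the top locus — untouchable by ANY point-centred engine, the column where the in-frame bed
  mass sits (T-delta-bed: 27 of 30 residual rows in frame); ISO = all δ-special top points isolated (bed: 3 binary towers)).
* CENSUS `census/T-delta-bed.{py,json,md}` (117 bed rows + 13 controls, 7.6 s): in frame (dim Y ≤ 4) GENERIC-G1 6 (4 of
  them g10-DEEP curve points, 2 = g9 NEARGEN), GENERIC-G2 1 (g10-DEEP surface point `z² + x⁵ + y⁵`, p = 2), SPECIAL-FRAC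
  isolated 3, NONISO 27, not-core 10: the δ-engine DECIDES 5 of the 28 in-frame DEEP rows (bed margin > 0, unlike g10) and
  locates the rest: 21 DEEP + 6 POWER rows are NON-ISOLATED top points.
* Edges BY NAME (§6): `DeltaGenericRung → FFGenericRung` (31576), `FFSpecialRung → DeltaSpecialRung` (31577),
  `FFSpecialRung ⟺ DeltaSpecialRung` modulo `DeltaGenericRung`, `FFSpecialDeep → Far ∧ Mid` (31578),
`FFSpecialCritical →
  Crit` (31579), `closes_core` (28544), `closes_closedPointCore` (30461).
-/

open CategoryTheory AlgebraicGeometry TopologicalSpace IsLocalRing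
open Literature.AlgebraicGeometry.Resolution
open Summit.ResolutionOfSingularities.ResolutionOfSingularities.Theorems
open Summit.ResolutionOfSingularities.ResolutionOfSingularities.Theorems.WeakOrderReduction

namespace Summit.ResolutionOfSingularities.ResolutionOfSingularities.Theorems.DeltaFaceCutClasses

/-! ## §0  Weights: the slope `δ = a/b`, the weighted degree, `θ = ⌈δ⌉ − δ`, the package length `m =
⌈δ⌉ − 1` -/

/-- The `u`-degree `|α| = Σ_{j ≥ 1} m_j` of an exponent vector on `(z, u₁, …, u_d)`.  DEFINITION (support).
[folklore] -/
def uDeg {d : ℕ} (m : Fin (d + 1) →₀ ℕ) : ℕ := Finset.univ.sum fun j : Fin d => m (Fin.succ j)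

/-- The WEIGHTED DEGREE `a·m₀ + b·|α|` of an exponent vector (`z ↦ a`, `u_j ↦ b`; slope `δ = a/b`).  DEFINITION (NEW
object, support). (Sources: Hironaka1967; CossartJannsenSaito2020 Ch. 8.) -/
def wdeg {d : ℕ} (a b : ℕ) (m : Fin (d + 1) →₀ ℕ) : ℕ := a * m 0 + b * uDeg m

/-- `θ·b` for `θ := ⌈δ⌉ − δ` (`δ = a/b ∉ ℤ`): `b − (a mod b)`.  DEFINITION (support). (Sources: Hironaka1967.) -/
def thetaNum (a b : ℕ) : ℕ := b - a % b

/-- The PACKAGE LENGTH `m = ⌈a/b⌉ − 1` (number of blow-ups dictated by the δ-face).  DEFINITION (support,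
informational). (Sources: Hironaka1967; Moh1987.) -/
def packageLength (a b : ℕ) : ℕ := (a + b - 1) / b - 1

/-! ## §1  Ring level: monomial valuation ideals of the weight, the δ-face presentation, genericity of the δ-initial form -/

section Face

variable {R : Type} [CommRing R] {d : ℕ}

/-- The monomial `cᵐ = ∏ c_j^{m_j}` in the regular parameters.  DEFINITION (support). [folklore] -/
noncomputable def cMon (c : Fin (d + 1) → R) (m : Fin (d + 1) →₀ ℕ) : R := m.prod fun j e => c j ^ e

/-- **`Q(λ) = qWeighted c a b λ`** — the ideal generated by the monomials `zⁱuᵅ` of weighted degree `a i + b|α| ≥ λ`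
(the valuation ideals of the monomial valuation of weight `(a; b, …, b)`; `J ⊆ Q(an)` ⟺ Hironaka's `δ(J; u; z) ≥ a/b`,
cf. the tree's `Literature…CossartPiltant.DeltaGE`).  DEFINITION (NEW object). (Sources: Hironaka1967;
CossartJannsenSaito2020 Ch. 8; CossartPiltant2019 Prop. 2.6.) -/
def qWeighted (c : Fin (d + 1) → R) (a b l : ℕ) : Ideal R :=
  Ideal.span {x | ∃ m : Fin (d + 1) →₀ ℕ, l ≤ wdeg a b m ∧ x = cMon c m}

/-- **δ-FACE PRESENTATION `HasDeltaFace c J n a b F`**: `0 < b < a` (slope `δ = a/b > 1`); `F` is supported on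
monomials of weight EXACTLY `a n` with `z`-degree `< n` (the face, `Zⁿ` excluded); `J ∋ zⁿ + F(c) + G(c)` for some `G`
supported in weight `> a n`; and the WHOLE ideal is δ-deep, `J ⊆ Q(an)` (needed for the admissibility of the
intermediate centres `C_j`, proof step (1)).  DEFINITION (NEW object). (Sources: Hironaka1967;
CossartJannsenSaito2020 Ch. 8; CossartPiltant2019 Prop. 2.6.) -/
def HasDeltaFace (c : Fin (d + 1) → R) (J : Ideal R) (n a b : ℕ) (F : MvPolynomial (Fin (d + 1)) R) : Prop :=
  0 < b ∧ b < a ∧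
    (∀ m ∈ F.support, wdeg a b m = a * n ∧ m 0 < n) ∧
    (∃ G : MvPolynomial (Fin (d + 1)) R, (∀ m ∈ G.support, a * n < wdeg a b m) ∧
        c 0 ^ n + MvPolynomial.eval c F + MvPolynomial.eval c G ∈ J) ∧
    J ≤ qWeighted c a b (a * n)

end Face

section Genericity

variable {K : Type} [Field K] {d : ℕ}

/-- Base change of a residue polynomial to the algebraic closure (geometric points).  DEFINITION (support). [folklore] -/
noncomputable def geom (P : MvPolynomial (Fin (d + 1)) K) : MvPolynomial (Fin (d + 1)) (AlgebraicClosure K) :=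
  MvPolynomial.map (algebraMap K (AlgebraicClosure K)) P

/-- The Taylor translate `P(X + v)`.  DEFINITION (support). [folklore] -/
noncomputable def translate (P : MvPolynomial (Fin (d + 1)) (AlgebraicClosure K))
    (v : Fin (d + 1) → AlgebraicClosure K) : MvPolynomial (Fin (d + 1)) (AlgebraicClosure K) :=
  MvPolynomial.aeval (fun i => MvPolynomial.X i + MvPolynomial.C (v i)) P

/-- Restriction to the line of the direction `v` inside `{U}`-space: `Z ↦ Z`, `U_j ↦ v_j` — the one-variable
polynomial `P(Z, v)`.  DEFINITION (support). [folklore] -/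
noncomputable def restrictLine (P : MvPolynomial (Fin (d + 1)) (AlgebraicClosure K))
    (v : Fin (d + 1) → AlgebraicClosure K) : MvPolynomial (Fin (d + 1)) (AlgebraicClosure K) :=
  MvPolynomial.aeval
    (Fin.cases (motive := fun _ => MvPolynomial (Fin (d + 1)) (AlgebraicClosure K)) (MvPolynomial.X 0)
      fun j => MvPolynomial.C (v j.succ)) P

/-- **(G1) `ThresholdGeneric P n a b`** (`δ = a/b ∉ ℤ`): at EVERY geometric direction `v` of `{Y₀ = 0}` some face
component `Ψ_i` has multiplicity `< θ(n−i)`: some monomial `ZⁱUᵝ` of the translate `P(Z, U + v)` has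
`θb·i + b·|β| < θb·n`.  By the engine, NO point over `y` is near after the package.  DEFINITION (NEW object).
(Sources: Hironaka1967; CossartPiltant2008 proof of Prop. 4.2.) -/
def ThresholdGeneric (P : MvPolynomial (Fin (d + 1)) K) (n a b : ℕ) : Prop :=
  ¬ b ∣ a ∧ ∀ v : Fin (d + 1) → AlgebraicClosure K, v ≠ 0 → v 0 = 0 →
    ∃ m ∈ (translate (geom P) v).support, thetaNum a b * m 0 + b * uDeg m < thetaNum a b * n

/-- **(G2) `ThresholdGenericPow P n a b`** (`δ ∉ ℤ`, marking `n = pᵉ` a power of the residue characteristic): at every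
geometric direction some `Ψ_i` has multiplicity `≤ θ(n−i)`; an exact-threshold face monomial is MIXED in the initial
form at a near point, which is therefore not a `pᵉ`-th power of a linear form: `τ ≥ 2`.  DEFINITION (NEW
object). (Sources: CossartPiltant2008 proof of Prop. 4.2 (b); CossartPiltant2019 Rem. 3.2.) -/
def ThresholdGenericPow (P : MvPolynomial (Fin (d + 1)) K) (n a b : ℕ) : Prop :=
  ¬ b ∣ a ∧ (∃ e : ℕ, n = ringChar K ^ e) ∧ ∀ v : Fin (d + 1) → AlgebraicClosure K, v ≠ 0 → v 0 = 0 →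
    ∃ m ∈ (translate (geom P) v).support, thetaNum a b * m 0 + b * uDeg m ≤ thetaNum a b * n

/-- **(G3) `SolvGeneric P n a b`** (`δ ∈ ℤ`): at every geometric direction `v ≠ 0` the monic `Zⁿ + P(Z, v)` is NOT the
`n`-th power of a linear monic over `k̄` (after the package the degree-`n` initial form at a near point of direction `v`
is the binary form `Zⁿ + P(Z, U₁v)`, and `τ = 1` iff it is `(Z + tU₁)ⁿ`).  DEFINITION (NEW object).
(Sources: Hironaka1967; Moh1987; CossartJannsenSaito2020 Ch. 8.) -/
def SolvGeneric (P : MvPolynomial (Fin (d + 1)) K) (n a b : ℕ) : Prop :=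
  b ∣ a ∧ ∀ v : Fin (d + 1) → AlgebraicClosure K, v ≠ 0 → v 0 = 0 →
    ∀ t : AlgebraicClosure K,
      MvPolynomial.X 0 ^ n + restrictLine (geom P) v ≠ (MvPolynomial.X 0 + MvPolynomial.C t) ^ n

/-- **δ-GENERIC δ-initial form**: one of the three decided genericity modes.  DEFINITION (NEW object). (Sources:
Hironaka1967; CossartPiltant2008 Prop. 4.2.) -/
def DeltaGenericFace (P : MvPolynomial (Fin (d + 1)) K) (n a b : ℕ) : Prop :=
  ThresholdGeneric P n a b ∨ ThresholdGenericPow P n a b ∨ SolvGeneric P n a b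

end Genericity

/-! ## §2  The engine's output predicate (a weakly admissible EXIT PACKAGE over `y`), the ENGINE, the bookkeeping port -/

/-- **`PackageExitsAt I n y`** — there is a weakly admissible sequence of blow-ups for `(I, ∅, n)`, all of whose
centres lie over `y`, with regular top, after which every point over `y` of order `n` for the transformed ideal has
`τ ≥ 2` (tree `CentreSeq`, `WeakAdmissible`, `CentresOver`, `transformMarked`, `tauAt`).  The empty sequence witnesses
it at a point with `τ(y) ≥ 2`; at a contact-free `τ = 1` point its content is the PACKAGE.  DEFINITION (NEW object; the
conclusion shape of the engine and the hypothesis shape of the port). (Sources: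
BierstoneGrigorievMilmanWlodarczyk2011 Def. 3.1.3; CossartPiltant2008 Prop. 4.2.) -/
def PackageExitsAt {Y : Scheme.{0}} (I : Y.IdealSheafData) (n : ℕ) (y : Y) : Prop :=
  IsLocallyNoetherian Y →
    ∃ s : CentreSeq Y, WeakAdmissible s (⟨I, [], n⟩ : MarkedIdeal Y) ∧ s.CentresOver ({y} : Set Y) ∧
      ∃ hT : Scheme.IsRegular s.top, ∀ x : s.top, s.comp x = y →
        idealOrder (s.transformMarked (⟨I, [], n⟩ : MarkedIdeal Y)).ideal x = ((n : ℕ) : ℕ∞) →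
          2 ≤ tauAt hT (s.transformMarked (⟨I, [], n⟩ : MarkedIdeal Y)).ideal n x

/-- **ENGINE `DeltaPackageExit`** [DECIDED · paper proof in the module docstring ((0) structure of the package, (1)
admissibility from `J ⊆ Q(an)`, (2) location of the near points on `C_j`, (3) the x-prepared expansion at ANY point of
`C_m` with the cancellation-free readings (N) order and (I) initial form, then G1 / G2 / G3) · characteristic free,
EVERY regular scheme, every residue field, every dimension · port L over `CentreSeq` / `controlledTransform` / `stalkTau`
(siblings in the tree: `IsBlowup.not_isNear_of_stalkTau_eq_three`, the origin chart law `CharPolyhedronOriginChart`)]: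
at a closed top point `y` of order `n ≥ 2` on a regular scheme, a δ-face presentation in a MINIMAL regular system of
parameters (`d + 1 = embdim`) with δ-generic δ-initial form yields an exit package.  STATEMENT (engine). (Sources:
Hironaka1967; CossartPiltant2008 Prop. 4.2, Lemma 4.3; CossartJannsenSaito2020 Ch. 8–9; Moh1987.) -/
def DeltaPackageExit : Prop :=
  ∀ (Y : Scheme.{0}) (hY : Scheme.IsRegular Y) (I : Y.IdealSheafData) (n : ℕ), 2 ≤ n →
    ∀ y : Y, IsClosed ({y} : Set Y) → idealOrder I y = ((n : ℕ) : ℕ∞) →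
      ∀ (d : ℕ) (c : Fin (d + 1) → Y.presheaf.stalk y),
        Ideal.span (Set.range c) = maximalIdeal (Y.presheaf.stalk y) →
        (maximalIdeal (Y.presheaf.stalk y)).spanFinrank = d + 1 →
        ∀ (a b : ℕ) (F : MvPolynomial (Fin (d + 1)) (Y.presheaf.stalk y)),
          HasDeltaFace c (stalkIdeal I y) n a b F →
          DeltaGenericFace (MvPolynomial.map (residue (Y.presheaf.stalk y)) F) n a b →
            PackageExitsAt I n y

/-- **PACKAGE-EXIT point**: closed, isolated in the top locus, with an exit package.  DEFINITION (NEW class; hypothesis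
shape of the port). [folklore] -/
def IsPackageExitPt {Y : Scheme.{0}} (I : Y.IdealSheafData) (n : ℕ) (y : Y) : Prop :=
  IsClosed ({y} : Set Y) ∧ FaceFormCutClasses.IsIsolatedTop I n y ∧ PackageExitsAt I n y

/-- **`PackagePort n`** [COSTUME(M+) · engine-free bookkeeping, the g9 port `OneShotPort` with packages]: if every top
point of a dim-4 datum is of class ≥ 2, a (one-shot) EXIT point of g9, or a PACKAGE-EXIT point, then `SeqDimFour 2 n`
already yields a weak resolution — the isolated closed exit points are finitely many (irreducible components of the
noetherian top locus); run the exit package of the first (a weakly admissible prefix with centres over it; off its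
fibre the composite is an isomorphism, so orders, classes and the exit property of the other points are transported —
`IsBlowup.idealOrder_controlledTransform_eq_of_not_mem_support`), over it every near point has class ≥ 2, `ord ≤ n`
persists ([CossartPiltant2008] Prop. 4.2 (a)); after the last exit point apply `SeqDimFour 2 n` to the transformed FRESH
datum and concatenate (`CentreSeq.append`, `transformMarked_append`).  STATEMENT (port). (Sources:
BierstoneGrigorievMilmanWlodarczyk2011 Def. 3.1.3; CossartPiltant2008 Prop. 4.2.) -/
def PackagePort (n : ℕ) : Prop :=
  SeqDimFour 2 n →
  ∀ p : ℕ, p.Prime → ∀ (k : Type) [Field k] [CharP k p]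
    (Y : Scheme.{0}) (g : Y ⟶ Spec (.of k)), IsSeparated g → LocallyOfFiniteType g → QuasiCompact g →
    ∀ hY : Scheme.IsRegular Y, topologicalKrullDim Y ≤ 4 →
    ∀ I : Y.IdealSheafData, (∀ y : Y, idealOrder I y ≤ ((n : ℕ) : ℕ∞)) →
      (∀ y : Y, idealOrder I y = ((n : ℕ) : ℕ∞) →
        ClassGE g hY I n 2 y ∨ FaceFormCutClasses.IsExitPt I n y ∨ IsPackageExitPt I n y) →
      ∃ t : CentreSeq Y, WeakResolution t (⟨I, [], n⟩ : MarkedIdeal Y)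

/-! ## §3  Pointwise classes at a top point -/

/-- **δ-GENERIC top point** (THE DECIDED CLASS): closed, isolated in the top locus, and in some minimal regular system
of parameters and some slope `a/b > 1` the stalk ideal has a δ-face presentation with δ-generic δ-initial form.
DEFINITION (NEW class). (Sources: Hironaka1967; CossartPiltant2008 Prop. 4.2.) -/
def IsDeltaGenericPt {Y : Scheme.{0}} (I : Y.IdealSheafData) (n : ℕ) (y : Y) : Prop :=
  IsClosed ({y} : Set Y) ∧ FaceFormCutClasses.IsIsolatedTop I n y ∧
    ∃ (d : ℕ) (c : Fin (d + 1) → Y.presheaf.stalk y),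
      Ideal.span (Set.range c) = maximalIdeal (Y.presheaf.stalk y) ∧
        (maximalIdeal (Y.presheaf.stalk y)).spanFinrank = d + 1 ∧
        ∃ (a b : ℕ) (F : MvPolynomial (Fin (d + 1)) (Y.presheaf.stalk y)),
          HasDeltaFace c (stalkIdeal I y) n a b F ∧
            DeltaGenericFace (MvPolynomial.map (residue (Y.presheaf.stalk y)) F) n a b

/-- **FAR point** («δ ≥ 2 in some minimal regular system»): a deep face (`HasDeepFace`, tree) AND the whole stalk
ideal inside `Q_{(2;1,…,1)}(2n)` — the first blow-up is inert along the whole `E ∩ H̃ ≅ ℙ^{d−1}`.  DEFINITION (NEW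
class; stratum predicate). (Sources: Hironaka1967; Moh1987.) -/
def IsFarPt {Y : Scheme.{0}} (I : Y.IdealSheafData) (n : ℕ) (y : Y) : Prop :=
  ∃ (d : ℕ) (c : Fin (d + 1) → Y.presheaf.stalk y),
    Ideal.span (Set.range c) = maximalIdeal (Y.presheaf.stalk y) ∧
      (maximalIdeal (Y.presheaf.stalk y)).spanFinrank = d + 1 ∧
      FaceFormCutClasses.HasDeepFace c (stalkIdeal I y) n ∧ stalkIdeal I y ≤ qWeighted c 2 1 (2 * n)

/-- **δ-SPECIAL core point** (THE LOCATED CLASS of this node): a face-special core top point (tree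
`FaceFormCutClasses.IsFaceSpecialPt`: not of class ≥ 2, not face-generic) that is NOT δ-generic.  DEFINITION (NEW
class). [folklore] -/
def IsDeltaSpecialPt {k : Type} [Field k] {Y : Scheme.{0}} (g : Y ⟶ Spec (.of k)) (hY : Scheme.IsRegular Y)
    (I : Y.IdealSheafData) (n : ℕ) (y : Y) : Prop :=
  FaceFormCutClasses.IsFaceSpecialPt g hY I n y ∧ ¬ IsDeltaGenericPt I n y

/-! ## §4  The graded statements (fresh-data frame = the binders of `WeakOrderReduction.SeqDimFour`) -/

/-- **`SeqDGen n`** — weak order reduction in dimension four at marking `n` for data ALL of whose top points are of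
class ≥ 2, FACE-GENERIC (g9) or δ-GENERIC.  [DECIDED-MOD-PORT relative to `SeqDimFour 2 n`: `dGenRungAt_of_engines`.]
STATEMENT SCHEMA. (Sources: BierstoneGrigorievMilmanWlodarczyk2011 §3.1; CossartPiltant2008 Prop. 4.2; Hironaka1967.) -/
def SeqDGen (n : ℕ) : Prop :=
  ∀ p : ℕ, p.Prime → ∀ (k : Type) [Field k] [CharP k p]
    (Y : Scheme.{0}) (g : Y ⟶ Spec (.of k)), IsSeparated g → LocallyOfFiniteType g → QuasiCompact g →
    ∀ hY : Scheme.IsRegular Y, topologicalKrullDim Y ≤ 4 →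
    ∀ I : Y.IdealSheafData, (∀ y : Y, idealOrder I y ≤ ((n : ℕ) : ℕ∞)) →
      (∀ y : Y, idealOrder I y = ((n : ℕ) : ℕ∞) →
        (ClassGE g hY I n 2 y ∨ FaceFormCutClasses.IsFaceGenericPt I n y) ∨ IsDeltaGenericPt I n y) →
      ∃ t : CentreSeq Y, WeakResolution t (⟨I, [], n⟩ : MarkedIdeal Y)

/-- **`SeqDSpec n`** — THE LOCATED CLASS: weak order reduction in dimension four at marking `n` for data having a
δ-SPECIAL core top point.  [UNDECIDED · IDEA-NEEDED · INSTRUMENTABLE T-delta-bed.]  STATEMENT SCHEMA. (Sources: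
BierstoneGrigorievMilmanWlodarczyk2011 §3.1; CossartPiltant2019 Rem. 3.2; Moh1987.) -/
def SeqDSpec (n : ℕ) : Prop :=
  ∀ p : ℕ, p.Prime → ∀ (k : Type) [Field k] [CharP k p]
    (Y : Scheme.{0}) (g : Y ⟶ Spec (.of k)), IsSeparated g → LocallyOfFiniteType g → QuasiCompact g →
    ∀ hY : Scheme.IsRegular Y, topologicalKrullDim Y ≤ 4 →
    ∀ I : Y.IdealSheafData, (∀ y : Y, idealOrder I y ≤ ((n : ℕ) : ℕ∞)) →
      (∃ y : Y, idealOrder I y = ((n : ℕ) : ℕ∞) ∧ IsDeltaSpecialPt g hY I n y) →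
      ∃ t : CentreSeq Y, WeakResolution t (⟨I, [], n⟩ : MarkedIdeal Y)

/-- `SeqDSpecFar n` — FAR stratum: some δ-special core top point is FAR (`δ ≥ 2` in some system; bed: kangaroo, Moh
towers `δ = 2, 3`, weighted-quotient and Hauser–Perlega cylinders of high slope).  [UNDECIDED · INSTRUMENTABLE.]
(Sources: Moh1987; Hironaka1967; CossartJannsenSaito2020 Ch. 8.) -/
def SeqDSpecFar (n : ℕ) : Prop :=
  ∀ p : ℕ, p.Prime → ∀ (k : Type) [Field k] [CharP k p]
    (Y : Scheme.{0}) (g : Y ⟶ Spec (.of k)), IsSeparated g → LocallyOfFiniteType g → QuasiCompact g →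
    ∀ hY : Scheme.IsRegular Y, topologicalKrullDim Y ≤ 4 →
    ∀ I : Y.IdealSheafData, (∀ y : Y, idealOrder I y ≤ ((n : ℕ) : ℕ∞)) →
      (∃ y : Y, idealOrder I y = ((n : ℕ) : ℕ∞) ∧ IsDeltaSpecialPt g hY I n y ∧ IsFarPt I n y) →
      ∃ t : CentreSeq Y, WeakResolution t (⟨I, [], n⟩ : MarkedIdeal Y)

/-- `SeqDSpecMid n` — MID stratum: δ-special core top points exist, NONE of them is far, but some face-special top
point is deep-faced (`1 + 1/n < δ`, slope below `2` at the δ-special points; bed: `z² + x³y³ + …`-type, `E₈`-slopes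
`3/2, 5/3`).  [UNDECIDED · INSTRUMENTABLE.] (Sources: Hironaka1967; CossartJannsenSaito2020 Ch. 8.) -/
def SeqDSpecMid (n : ℕ) : Prop :=
  ∀ p : ℕ, p.Prime → ∀ (k : Type) [Field k] [CharP k p]
    (Y : Scheme.{0}) (g : Y ⟶ Spec (.of k)), IsSeparated g → LocallyOfFiniteType g → QuasiCompact g →
    ∀ hY : Scheme.IsRegular Y, topologicalKrullDim Y ≤ 4 →
    ∀ I : Y.IdealSheafData, (∀ y : Y, idealOrder I y ≤ ((n : ℕ) : ℕ∞)) →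
      (∃ y : Y, idealOrder I y = ((n : ℕ) : ℕ∞) ∧ IsDeltaSpecialPt g hY I n y) →
      (∀ y : Y, idealOrder I y = ((n : ℕ) : ℕ∞) → IsDeltaSpecialPt g hY I n y → ¬ IsFarPt I n y) →
      (∃ y : Y, idealOrder I y = ((n : ℕ) : ℕ∞) ∧
        FaceFormCutClasses.IsFaceSpecialPt g hY I n y ∧ FaceFormCutClasses.IsDeepFacePt I n y) →
      ∃ t : CentreSeq Y, WeakResolution t (⟨I, [], n⟩ : MarkedIdeal Y)

/-- `SeqDSpecCrit n` — CRITICAL stratum: δ-special core top points exist and NO face-special top point is deep-faced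
(`δ = 1 + 1/n` everywhere on the located class: the tree's CRITICAL stratum 31579 restricted; bed: CossartPiltant2019
Rem. 3.2 `Zᵖ + u₄u₁ᵖ + u₃u₂ᵖ`, Giraud's quadric, umbrella cylinders).  [UNDECIDED · INSTRUMENTABLE.]
(Sources: CossartPiltant2019 Rem. 3.2; Giraud1975.) -/
def SeqDSpecCrit (n : ℕ) : Prop :=
  ∀ p : ℕ, p.Prime → ∀ (k : Type) [Field k] [CharP k p]
    (Y : Scheme.{0}) (g : Y ⟶ Spec (.of k)), IsSeparated g → LocallyOfFiniteType g → QuasiCompact g →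
    ∀ hY : Scheme.IsRegular Y, topologicalKrullDim Y ≤ 4 →
    ∀ I : Y.IdealSheafData, (∀ y : Y, idealOrder I y ≤ ((n : ℕ) : ℕ∞)) →
      (∃ y : Y, idealOrder I y = ((n : ℕ) : ℕ∞) ∧ IsDeltaSpecialPt g hY I n y) →
      (∀ y : Y, idealOrder I y = ((n : ℕ) : ℕ∞) →
        FaceFormCutClasses.IsFaceSpecialPt g hY I n y → ¬ FaceFormCutClasses.IsDeepFacePt I n y) →
      ∃ t : CentreSeq Y, WeakResolution t (⟨I, [], n⟩ : MarkedIdeal Y)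

/-- `SeqDSpecNonIso n` — NON-ISOLATED column of the located class: some δ-special core top point is NOT isolated in
the top locus (the top locus has a positive-dimensional component through it: cylinders over lower-dimensional
singularities, products, the `(u₃,u₄)`-plane of CossartPiltant2019 Rem. 3.2).  No point-centred engine (g9 `FaceFormExit`,
g10, `DeltaPackageExit`) touches this column BY DEFINITION; its object is the δ-polyhedron TRANSVERSAL to a regular
positive-dimensional permissible centre inside the top locus (CJS «B-permissible» curve centres).  T-delta-bed: 27 of the
30 in-frame residual rows.  [UNDECIDED · IDEA-NEEDED (positive-dimensional centres) · INSTRUMENTABLE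
T-delta-transversal.] (Sources: CossartJannsenSaito2020 Ch. 5; CossartPiltant2019 Rem. 3.2; Hironaka1967.) -/
def SeqDSpecNonIso (n : ℕ) : Prop :=
  ∀ p : ℕ, p.Prime → ∀ (k : Type) [Field k] [CharP k p]
    (Y : Scheme.{0}) (g : Y ⟶ Spec (.of k)), IsSeparated g → LocallyOfFiniteType g → QuasiCompact g →
    ∀ hY : Scheme.IsRegular Y, topologicalKrullDim Y ≤ 4 →
    ∀ I : Y.IdealSheafData, (∀ y : Y, idealOrder I y ≤ ((n : ℕ) : ℕ∞)) →
      (∃ y : Y, idealOrder I y = ((n : ℕ) : ℕ∞) ∧ IsDeltaSpecialPt g hY I n y ∧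
        ¬ FaceFormCutClasses.IsIsolatedTop I n y) →
      ∃ t : CentreSeq Y, WeakResolution t (⟨I, [], n⟩ : MarkedIdeal Y)

/-- `SeqDSpecIso n` — ISOLATED column of the located class: δ-special core top points exist and EVERY one of them is
isolated in the top locus (bed, in frame: only the binary towers `z² + x^a + y^b`, `p = 2`, `a` odd, `E₈`-type — the
δ-test fails at the first package but the classical invariant drops along the tower).  [UNDECIDED · INSTRUMENTABLE
T-delta-tower (iterate the δ-test along the package) · candidate ATTACKABLE by induction on `(δ, bad-locus
degree)`.] (Sources: Hironaka1967; CossartJannsenSaito2020 Ch. 8; Moh1987.) -/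
def SeqDSpecIso (n : ℕ) : Prop :=
  ∀ p : ℕ, p.Prime → ∀ (k : Type) [Field k] [CharP k p]
    (Y : Scheme.{0}) (g : Y ⟶ Spec (.of k)), IsSeparated g → LocallyOfFiniteType g → QuasiCompact g →
    ∀ hY : Scheme.IsRegular Y, topologicalKrullDim Y ≤ 4 →
    ∀ I : Y.IdealSheafData, (∀ y : Y, idealOrder I y ≤ ((n : ℕ) : ℕ∞)) →
      (∃ y : Y, idealOrder I y = ((n : ℕ) : ℕ∞) ∧ IsDeltaSpecialPt g hY I n y) →
      (∀ y : Y, idealOrder I y = ((n : ℕ) : ℕ∞) → IsDeltaSpecialPt g hY I n y →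
        FaceFormCutClasses.IsIsolatedTop I n y) →
      ∃ t : CentreSeq Y, WeakResolution t (⟨I, [], n⟩ : MarkedIdeal Y)

/-- `DGenRungAt n` — the δ-generic rung at one marking: `SeqDimFour 2 n → SeqDGen n`.  [DECIDED-MOD-PORT, `n ≥ 2`:
`dGenRungAt_of_engines`; `n = 1`: `dGenRungAt_one`.] [folklore] -/
def DGenRungAt (n : ℕ) : Prop := SeqDimFour 2 n → SeqDGen n

/-- **`DeltaGenericRung`** — the δ-GENERIC half of `RungOne`: `E 2 →` weak order reduction for every marking and all
data whose core top points are face-generic or δ-generic.  [WEAKER · DECIDED-MOD-PORT(M+): `deltaGenericRung_of_engines`.]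
STATEMENT (decided piece). (Sources: CossartPiltant2008 Prop. 4.2; Hironaka1967.) -/
def DeltaGenericRung : Prop := E 2 → ∀ n : ℕ, 1 ≤ n → SeqDGen n

/-- **`DeltaSpecialRung`** — the δ-SPECIAL half of `RungOne` = THE LOCATED RESIDUAL of this node: `E 2 →` weak order
reduction for every marking and all data with a δ-special core top point.  [WEAKER BY LETTER · UNDECIDED · IDEA-NEEDED
· cofinal ⇒ score 0.]  STATEMENT (located residual). (Sources: CossartPiltant2019 Rem. 3.2; Moh1987; Giraud1975.) -/
def DeltaSpecialRung : Prop := E 2 → ∀ n : ℕ, 1 ≤ n → SeqDSpec n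

end Summit.ResolutionOfSingularities.ResolutionOfSingularities.Theorems.DeltaFaceCutClasses
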